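import Literature.Barriers.NavierStokesRegularity.SchefferSwitchedSolution
import Literature.Barriers.NavierStokesRegularity.NavierStokesInequalityProfilesProofs
import HarnessLib

/-!
# Scheffer's singular NSI solution: the assembly down to the geometric arrangement (fact C)

Barrier catalogue support file for `NavierStokesRegularity` (D-0021). State of the discharge of
the barrier fact `NavierStokesInequalitySingularSolution` (V. Scheffer, Comm. Math. Phys. 101
(1985), Thm. 1.1; W. S. Ożański, arXiv:1709.00602v4, Thm. 1.1) along its printed proof
(Scheffer, p. 84: "Theorem 1.1 is a consequence of Lemma 6.4, Lemma 3.3 and Lemma 2.4";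
Ożański, §2: block + switching, §4: block from the geometric arrangement, §5: the arrangement):

* fact A, the switching principle (Scheffer Lemmas 2.3–2.4; Ożański §2) — DISCHARGED,
  `nsiSwitching_holds` (`SchefferSwitchedSolution`);
* fact D, a block from an arrangement (Scheffer Lemmas 2.1, 3.1–3.3; Ożański §4, Lemma 4.1,
  Prop. 4.2, Thm. 4.3) — DISCHARGED, `NSIBlock_of_arrangement_holds`
  (`NavierStokesInequalityProfilesProofs`, from D-I `NSIBlock_of_profiles_holds` and D-II
  `NSIProfiles_of_arrangement_holds`);
* fact C, the existence of the geometric arrangement (Scheffer §4, §6, Lemmas 6.1–6.3; Ożański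
  §5) — `NSIArrangementExists`, OPEN in the tree.

This file records the two resulting implications, so that the discharge of fact C closes fact B
(`NSIBlockExists`) and the barrier fact itself in one line each:
`nsiBlockExists_of_nsiArrangementExists : NSIArrangementExists → NSIBlockExists` and
`navierStokesInequalitySingularSolution_of_nsiArrangementExists :
NSIArrangementExists → NavierStokesInequalitySingularSolution`. Nothing new is asserted; no
definitions.

## References

* V. Scheffer, *A solution to the Navier–Stokes inequality with an internal singularity*,
  Comm. Math. Phys. 101 (1985), 47–85: Thm. 1.1, Lemmas 2.3–2.4, 3.3, 6.4 and p. 84.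
  [`Scheffer1985`]
* W. S. Ożański, arXiv:1709.00602v4, §2 (p. 7), §4 (opening paragraph, Prop. 4.2), §5.
  [`Ozanski2017NSISingular`]
-/

noncomputable section

namespace Literature.Barriers.NavierStokesRegularity

/-- **Fact B from fact C** (Ożański 2017, §4, opening paragraph: given the geometric arrangement
of §5, §4 furnishes `T, ν₀, τ, z, G, u`; Scheffer 1985, Lemma 3.3 with §6): with fact D
discharged (`NSIBlock_of_arrangement_holds`), the existence of a geometric arrangement gives a
classical block. [cite: Ozanski2017NSISingular, §4 (opening paragraph)] [cite: Scheffer1985, Lemma 3.3] -/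
theorem nsiBlockExists_of_nsiArrangementExists (hC : NSIArrangementExists) : NSIBlockExists :=
  nsiBlockExists_of_arrangement hC NSIBlock_of_arrangement_holds

/-- **Scheffer's theorem from the geometric arrangement alone** (Scheffer 1985, p. 84: "Theorem
1.1 is a consequence of Lemma 6.4, Lemma 3.3 and Lemma 2.4"; Ożański 2017, §2, p. 7): facts A
and D being discharged, `NSIArrangementExists` (Ożański §5; Scheffer §§4, 6) implies the barrier
fact `NavierStokesInequalitySingularSolution`.
[cite: Scheffer1985, p. 84 (proof of Thm. 1.1)] [cite: Ozanski2017NSISingular, §2 p. 7] -/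
theorem navierStokesInequalitySingularSolution_of_nsiArrangementExists (hC : NSIArrangementExists) :
    NavierStokesInequalitySingularSolution :=
  navierStokesInequalitySingularSolution_of_nsiBlockExists
    (nsiBlockExists_of_nsiArrangementExists hC)

end Literature.Barriers.NavierStokesRegularity
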